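import Literature.MathematicalPhysics.QuantumFieldTheory.Balaban1983to89.Node00.Record12CarriersB12
import Literature.MathematicalPhysics.QuantumFieldTheory.Balaban1983to89.Node00.CarriersB8SubB

/-!
# NODE 00 (YM-PLAN Track A) — THE CARRIER-PINNED STAGE-12 RECORDS, III: THE [B8″] PIN over n05-c's four-law sub-index `IdxB8SubB` (`Node00/CarriersB8SubB`) lifted to
# `Stage12Params` (`pinB8SubB`), the five- and six-pin Stage-12 views with [B8″], their leaves BY NAME, and the record `IsRecordOfRecord₁₂CB10YZWB8subBB12` (SAME-datum
# companion in `₁₂CB10YZW`; faces; rebind; OLD ⇒ NEW from g32's three-law record `IsRecordOfRecord₁₂CB10YZWB8subB12`) — g32∕g33's `Record12Carriers` [B8′] rows +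
# `Record12CarriersB12` §3b restated with `IdxB8Sub ↦ IdxB8SubB` (sequel of both; nothing edited in place)

NODE 00 RECORD MODULE (seat `pub-ymgap-dag-n05-d` g4, 2026-08-27, taking node00-def g33's OPEN OFFER of 2026-08-26T20:31Z as the consumer).  APPEND-ONLY: a NEW importing
module; everything it reads is CONSUMED BY NAME.  WHY (referee flag J2′, ref-A g12; n05-c g2 `B8IdxB8LawsB`): the [B8] knits of record range over the FOUR-law sub-index
`IdxB8SubB θ` (the bond-set law №12 excludes the empty-bond members at which the b9-socket binder is refuted), so the record at which N05 is statable in ∃-currency at a NAMED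
residual layer (dag-lead WORDS-102 ∕ ref-E flag (f)) is the six-pin record WITH [B8″]; its slot `B8LeafOfRecordSubB θ λ` is the knits' conclusion shape letter for letter
(`Node00/CarriersB8SubB`).  ref-C g18 READ116's located condition (B8) carries over VERBATIM: the residual layers are DATA WITHOUT LAW and the datum does not read them
(`datumOfRecord₁₂_pinB8SubB : rfl`), so the ∀-form «∀ (D, w) of this record, `Dag.B8_main`» is false-or-vacuous as typed; N05 is booked only in ∃-currency at a named `λ`
(`…_rebind_of_isRecordOfRecord₁₂C` + a closer of the slot at that `λ`), never by this predicate alone.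
[Balaban1985RegularSpaces] = Commun. Math. Phys. **99** (1985) 75–102; [Balaban1987RG1] = Commun. Math. Phys. **109** (1987) 249–301; [Balaban1989LargeFieldII] = Commun. Math.
Phys. **122** (1989) 355–392.

WHAT IS DEFINED ∕ PROVED (kernel bookkeeping, 0 sorry).  §1 `Stage12Params.pinB8SubB` (+ `_X`, `_toStage3Params`, `_admissible_iff`, `F12OfRecord₁₂_pinB8SubB`,
`toStage5₁₂_pinB8SubB`, `Provisos₁₂.pinB8SubB`, `datumOfRecord₁₂_pinB8SubB` (rfl), `WOfRecord₁₂_pinB8SubB`); §2 views `view₁₂B8subBB10YZW` ∕ `view₁₂B12B8subBB10YZW` + leaves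
(`upOfRecord₅CS_view₁₂B8subBB10YZW_leaves`, `upOfRecord₅C_view₁₂B8subBB10YZW_b8_iff`, `upOfRecord₅CS_view₁₂B12B8subBB10YZW_leaves`); §3 **`IsRecordOfRecord₁₂CB10YZWB8subBB12`**,
`exists_world_…`, **`companion_of_…`** (same D∕C∕γ∕L in `₁₂CB10YZW`, witness `(θ.pinB12 lam12).pinB8SubB lam`; companion b8 typed-over-the-sub-family ⇒ record b8 surviving),
`exists_isRecordOfRecord₁₂C_of_…`, `leaves_iff_of_…`, `b4_b5_b6_b7_of_…`, `b8_b11_b10_main_iff_of_…`, `nodes_iff_bundles_of_…`, `b8_main_of_…_of_slots`,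
`b12_leaf_of_…_of_slots`, `…_rebind_of_isRecordOfRecord₁₂C`, **`exists_isRecordOfRecord₁₂CB10YZWB8subBB12_of_isRecordOfRecord₁₂CB10YZWB8subB12`** (OLD ⇒ NEW at the record).
HONEST FRAMING: definitions + kernel bookkeeping; NO estimate; nothing of Bałaban's asserted; N05 ∕ N07 ∕ N08 ∕ N09 NOT discharged; counts unmoved (5∕28); one finite T⁴ programme
at fixed ε — NOT continuum ∕ ℝ⁴ ∕ infinite volume ∕ OS ∕ mass gap ∕ Clay.  No `sorry`, no `axiom`, no `opaque`, no `instance`, no `notation`. -/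

noncomputable section

namespace Literature.MathematicalPhysics.QuantumFieldTheory.Balaban1983to89.Node00

open T4Continuum AveragingRT T4FiniteEpsInhabited FlowStep FlowStepRuns DagBinding T4DatumAssembly
open B8LeafKnitRS (B8LeafRS)
open B8IdxB8LawsB (IdxB8SubB famB8OfRecordSubB)
open scoped Matrix.Norms.L2Operator

/-! ## §1. The [B8″] pin lifts to Stage-12 parameters and passes through the Stage-12 view, provisos and datum -/

section PinB8SubB

variable (F : T4Family) (N : ℕ) [NeZero N]

/-- **The [B8″] pin of Stage-12 parameters** (`X`-re-binding over `withB8OfRecordSubB`: the [B8] group of record over n05-c's four-law sub-index `IdxB8SubB`).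
[cite: Balaban1985RegularSpaces, Thm 2 p.83 (objects of record, Stage 3′(X.B8″)); (1.12) p.78, p.77 (bond convention)] -/
def Stage12Params.pinB8SubB (θ : Stage12Params F N) (lam : ResidB8 θ.toStage3Params) : Stage12Params F N :=
  θ.rebindX F N fun P => (θ.res.X P).withB8OfRecordSubB θ.toStage3Params lam

/-- The [B8″]-pinned carrier family, unfolded (`rfl`). [cite: Balaban1985RegularSpaces, Lemma 1 – Thm 8 pp.79–101 (bookkeeping)] -/
theorem Stage12Params.pinB8SubB_X (θ : Stage12Params F N) (lam : ResidB8 θ.toStage3Params) (P : B12.RunParams) :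
    (θ.pinB8SubB F N lam).res.X P = (θ.res.X P).withB8OfRecordSubB θ.toStage3Params lam := rfl

/-- The [B8″] pin keeps the Stage-3 dictionary (`rfl`). [cite: Balaban1985RegularSpaces, p.77 (bookkeeping)] -/
theorem Stage12Params.pinB8SubB_toStage3Params (θ : Stage12Params F N) (lam : ResidB8 θ.toStage3Params) :
    (θ.pinB8SubB F N lam).toStage3Params = θ.toStage3Params := rfl

/-- Admissibility is unchanged by the [B8″] pin (`Iff.rfl`). [cite: Balaban1983RegularityDecay, (1.6) p.572 (bookkeeping)] -/
theorem Stage12Params.pinB8SubB_admissible_iff (θ : Stage12Params F N) (lam : ResidB8 θ.toStage3Params) : (θ.pinB8SubB F N lam).Admissible F N ↔ θ.Admissible F N :=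
  Iff.rfl

/-- The [B8″] pin keeps the Stage-3 dictionary and the [B12] frame of record (`rfl` ×2). [cite: Balaban1987RG1, Lemma 4 p.280 (bookkeeping)] -/
theorem F12OfRecord₁₂_pinB8SubB (θ : Stage12Params F N) (lam8 : ResidB8 θ.toStage3Params) (lam : ResidB12 F N θ.τ9.M) (p : B12.RunParams) :
    (θ.pinB8SubB F N lam8).toStage3Params = θ.toStage3Params ∧ F12OfRecord₁₂ F N (θ.pinB8SubB F N lam8) lam p = F12OfRecord₁₂ F N θ lam p := ⟨rfl, rfl⟩

/-- The Stage-12 view of [B8″]-pinned parameters IS the re-bound Stage-12 view (`rfl`, through `toStage5₁₂_rebindX`). [cite: Balaban1988Convergent, p.244 (bookkeeping)] -/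
theorem Stage12Params.toStage5₁₂_pinB8SubB (θ : Stage12Params F N) (lam8 : ResidB8 θ.toStage3Params) :
    (θ.pinB8SubB F N lam8).toStage5₁₂ F N = (θ.toStage5₁₂ F N).rebindX F N (fun P => (θ.res.X P).withB8OfRecordSubB θ.toStage3Params lam8) :=
  Stage12Params.toStage5₁₂_rebindX F N θ _

variable {F N} in
/-- The Stage-12 provisos transport along the [B8″] pin. [cite: Balaban1988Convergent, (2.23)–(2.42) pp.259–262 (bookkeeping)] -/
theorem Stage12Params.Provisos₁₂.pinB8SubB {θ : Stage12Params F N} (h : θ.Provisos₁₂ F N) (lam : ResidB8 θ.toStage3Params) : (θ.pinB8SubB F N lam).Provisos₁₂ F N :=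
  h.rebindX _

/-- UP-SIDE: the datum of record is unchanged by the [B8″] pin (`rfl` underneath: the datum does not read the residual [B8] layer).
[cite: Balaban1989LargeFieldII, Thm 1 + (0.1) pp.355–356 (bookkeeping)] -/
theorem datumOfRecord₁₂_pinB8SubB (θ : Stage12Params F N) (h : θ.Provisos₁₂ F N) (lam : ResidB8 θ.toStage3Params) :
    datumOfRecord₁₂ F N (θ.pinB8SubB F N lam) (h.pinB8SubB lam) = datumOfRecord₁₂ F N θ h :=
  datumOfRecord₁₂_rebindX F N θ h _ (h.pinB8SubB lam)

/-- `WOfRecord₁₂` does not read the [B8″]-pinned fields (`rfl`). [cite: Balaban1989LargeFieldI, (0.2) p.176 (bookkeeping)] -/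
theorem WOfRecord₁₂_pinB8SubB (θ : Stage12Params F N) (lam8 : ResidB8 θ.toStage3Params) (lamW : ResidW F N) :
    WOfRecord₁₂ F N (θ.pinB8SubB F N lam8) lamW = WOfRecord₁₂ F N θ lamW := rfl

/-! ## §2. The five- and six-pin Stage-12 views with [B8″] and their leaves by name -/

/-- **The five-pin Stage-12 view with [B8″]** ([B8″] innermost). [cite: Balaban1985RegularSpaces, Thm 2 p.83 (objects of record)] -/
def Stage12Params.view₁₂B8subBB10YZW (θ : Stage12Params F N) (lam : ResidB8 θ.toStage3Params) (Mstar : ℕ) (ops : OpsY N θ.toStage3Params Mstar) (ζ : ResidZ F N)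
    (lamW : ResidW F N) : Stage5Params F N :=
  (θ.pinB8SubB F N lam).view₁₂B10YZW F N Mstar ops ζ lamW

/-- **The six-pin Stage-12 view with [B12] and [B8″]** ([B12] innermost). [cite: Balaban1987RG1, Lemma 4 p.280; Balaban1985RegularSpaces, Thm 2 p.83 (objects of record)] -/
def Stage12Params.view₁₂B12B8subBB10YZW (θ : Stage12Params F N) (lam12 : ResidB12 F N θ.τ9.M) (lam : ResidB8 θ.toStage3Params) (Mstar : ℕ)
    (ops : OpsY N θ.toStage3Params Mstar) (ζ : ResidZ F N) (lamW : ResidW F N) : Stage5Params F N :=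
  (θ.pinB12 F N lam12).view₁₂B8subBB10YZW F N lam Mstar ops ζ lamW

/-- The leaves of the S-binding over the five-pin view with [B8″], by name (`b8` is `Iff.rfl`). [cite: Balaban1985RegularSpaces, Lemma 1 – Thm 8 pp.79–101; Balaban1989LargeFieldI, Prop. 1 p.194; Balaban1985BackgroundPropagators, Thm 3.1 p.397; Balaban1985UV3, Thm 1 p.257; Balaban1985Variational, Thm 1 p.279] -/
theorem upOfRecord₅CS_view₁₂B8subBB10YZW_leaves (θ : Stage12Params F N) (lam : ResidB8 θ.toStage3Params) (Mstar : ℕ) (ops : OpsY N θ.toStage3Params Mstar)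
    (ζ : ResidZ F N) (lamW : ResidW F N) (P : B12.RunParams) :
    ((upOfRecord₅CS F N (θ.view₁₂B8subBB10YZW F N lam Mstar ops ζ lamW) P).b8 ↔ B8LeafOfRecordSubB θ.toStage3Params lam) ∧
    ((upOfRecord₅CS F N (θ.view₁₂B8subBB10YZW F N lam Mstar ops ζ lamW) P).rBasicStep ↔ B15Leaf (WOfRecord₁₂ F N θ lamW P)) ∧
    ((upOfRecord₅CS F N (θ.view₁₂B8subBB10YZW F N lam Mstar ops ζ lamW) P).b9 ↔ B9LeafX (Y9OfRecord N θ.toStage3Params Mstar ops)) ∧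
    ((upOfRecord₅CS F N (θ.view₁₂B8subBB10YZW F N lam Mstar ops ζ lamW) P).b10 ↔ PrintedUV3V N θ.L) ∧
    ((upOfRecord₅CS F N (θ.view₁₂B8subBB10YZW F N lam Mstar ops ζ lamW) P).b11 ↔ B11Leaf (Z11OfRecord F N ζ)) :=
  ⟨Iff.rfl, upOfRecord₅C_view₁₂B10YZW_leaves F N (θ.pinB8SubB F N lam) Mstar ops ζ lamW P⟩

/-- … and the C-binding's `b8` over it is the leaf AS TYPED at the re-keyed group of record (`Iff.rfl`). [cite: Balaban1985RegularSpaces, Lemma 1 – Thm 8 pp.79–101 (bookkeeping)] -/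
theorem upOfRecord₅C_view₁₂B8subBB10YZW_b8_iff (θ : Stage12Params F N) (lam : ResidB8 θ.toStage3Params) (Mstar : ℕ) (ops : OpsY N θ.toStage3Params Mstar)
    (ζ : ResidZ F N) (lamW : ResidW F N) (P : B12.RunParams) :
    (upOfRecord₅C F N (θ.view₁₂B8subBB10YZW F N lam Mstar ops ζ lamW) P).b8 ↔
      B8LeafR θ.D (θ.L : ℝ) lam.C₂ lam.B₁' lam.inp.B₀' lam.B₁ lam.B₂ lam.c₁ lam.inp lam.B₀β (B8Lemma1NonAbelian.blockPairNA θ.D θ.L θ.𝔸)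
        (fun j : IdxB8SubB θ.toStage3Params => famB8OfRecordSubB θ.toStage3Params lam.β lam.len j) lam.lan lam.cub (fun j => lam.toAxial j.1) :=
  Iff.rfl

/-- **THE SIX LEAVES OF THE S-BINDING OVER THE SIX-PIN VIEW WITH [B8″]**, by name (`b12`, `b8` by `Iff.rfl`). [cite: Balaban1987RG1, Lemma 4 p.280; Balaban1985RegularSpaces, Lemma 1 – Thm 8 pp.79–101; Balaban1989LargeFieldI, Prop. 1 p.194; Balaban1985BackgroundPropagators, Thm 3.1 p.397; Balaban1985UV3, Thm 1 p.257; Balaban1985Variational, Thm 1 p.279] -/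
theorem upOfRecord₅CS_view₁₂B12B8subBB10YZW_leaves (θ : Stage12Params F N) (lam12 : ResidB12 F N θ.τ9.M) (lam : ResidB8 θ.toStage3Params) (Mstar : ℕ)
    (ops : OpsY N θ.toStage3Params Mstar) (ζ : ResidZ F N) (lamW : ResidW F N) (P : B12.RunParams) :
    ((upOfRecord₅CS F N (θ.view₁₂B12B8subBB10YZW F N lam12 lam Mstar ops ζ lamW) P).b12 ↔ B12LeafOfRecord₁₂ F N θ lam12 P) ∧
    ((upOfRecord₅CS F N (θ.view₁₂B12B8subBB10YZW F N lam12 lam Mstar ops ζ lamW) P).b8 ↔ B8LeafOfRecordSubB θ.toStage3Params lam) ∧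
    ((upOfRecord₅CS F N (θ.view₁₂B12B8subBB10YZW F N lam12 lam Mstar ops ζ lamW) P).rBasicStep ↔ B15Leaf (WOfRecord₁₂ F N θ lamW P)) ∧
    ((upOfRecord₅CS F N (θ.view₁₂B12B8subBB10YZW F N lam12 lam Mstar ops ζ lamW) P).b9 ↔ B9LeafX (Y9OfRecord N θ.toStage3Params Mstar ops)) ∧
    ((upOfRecord₅CS F N (θ.view₁₂B12B8subBB10YZW F N lam12 lam Mstar ops ζ lamW) P).b10 ↔ PrintedUV3V N θ.L) ∧
    ((upOfRecord₅CS F N (θ.view₁₂B12B8subBB10YZW F N lam12 lam Mstar ops ζ lamW) P).b11 ↔ B11Leaf (Z11OfRecord F N ζ)) :=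
  ⟨Iff.rfl, upOfRecord₅CS_view₁₂B8subBB10YZW_leaves F N (θ.pinB12 F N lam12) lam Mstar ops ζ lamW P⟩

end PinB8SubB

/-! ## §3. `IsRecordOfRecord₁₂CB10YZWB8subBB12` — all six groups pinned, [B8] over the four-law sub-index; companion; faces; rebind; OLD ⇒ NEW from the three-law record -/

section Record12B8subB

variable (F : T4Family) (N : ℕ) [NeZero N]

/-- **«(D, w) is the record, Stage 12, all SIX typed carrier groups pinned, [B8] over the FOUR-LAW SUB-INDEX of record, `b8` surviving»**: g32's `IsRecordOfRecord₁₂CB10YZWB8subB12`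
VERBATIM at the six-pin view with [B8″] (residual layers quantified with the record's parameters; no law assumed beyond the sub-index's).
[cite: Balaban1985RegularSpaces, Lemma 1 – Thm 8 pp.79–101, (1.12) p.78; Balaban1987RG1, Lemma 4 p.280; Balaban1989LargeFieldII, Thm 1 + (0.1) pp.355–356 (objects of record)] -/
def IsRecordOfRecord₁₂CB10YZWB8subBB12 (D : FiniteEpsData F (SU N)) (w : WorldP) : Prop :=
  ∃ (θ : Stage12Params F N) (h : θ.Provisos₁₂ F N) (lam12 : ResidB12 F N θ.τ9.M) (lam : ResidB8 θ.toStage3Params) (Mstar : ℕ) (ops : OpsY N θ.toStage3Params Mstar)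
    (ζ : ResidZ F N) (lamW : ResidW F N),
    θ.Admissible F N ∧ D = datumOfRecord₁₂ F N θ h ∧ w.C = D.C ∧ (0 < w.γ ∧ w.γ ≤ θ.γ) ∧ w.L = (θ.L : ℝ) ∧
      ∀ P : B12.RunParams, w.up P = upOfRecord₅CS F N (θ.view₁₂B12B8subBB10YZW F N lam12 lam Mstar ops ζ lamW) P

/-- Inhabitation is Stage 12's exactly (all six residual types inhabited). [cite: Balaban1989LargeFieldII, Thm 1 + (0.1) pp.355–356 (bookkeeping)] -/
theorem exists_world_isRecordOfRecord₁₂CB10YZWB8subBB12 (θ : Stage12Params F N) (h : θ.Provisos₁₂ F N) (hθ : θ.Admissible F N) (lam12 : ResidB12 F N θ.τ9.M)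
    (lam : ResidB8 θ.toStage3Params) (Mstar : ℕ) (ops : OpsY N θ.toStage3Params Mstar) (ζ : ResidZ F N) (lamW : ResidW F N) {γw : ℝ} (hγw : 0 < γw ∧ γw ≤ θ.γ) :
    ∃ w : WorldP, IsRecordOfRecord₁₂CB10YZWB8subBB12 F N (datumOfRecord₁₂ F N θ h) w ∧ w.γ = γw := by
  obtain ⟨w₀, -, -⟩ := exists_world_isRecordOfRecord₁₂C F N θ h hθ hγw
  exact ⟨{ w₀ with
      C := (datumOfRecord₁₂ F N θ h).C, γ := γw, L := (θ.L : ℝ), one_lt_L := by exact_mod_cast θ.hL.2,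
      up := fun P => upOfRecord₅CS F N (θ.view₁₂B12B8subBB10YZW F N lam12 lam Mstar ops ζ lamW) P },
    ⟨θ, h, lam12, lam, Mstar, ops, ζ, lamW, hθ, rfl, rfl, hγw, rfl, fun _ => rfl⟩, rfl⟩

variable {F N}
variable {D : FiniteEpsData F (SU N)} {w : WorldP}

/-- **THE SAME-DATUM COMPANION IN `IsRecordOfRecord₁₂CB10YZW`** (witness `(θ.pinB12 lam12).pinB8SubB lam` under the C-binding): same `D`, `C`, window, `L`; leaves agree off `b8`;
companion's `b8` (typed, over the four-law sub-family) ⇒ record's `b8` (surviving, over the four-law sub-family) under the carrier law (1.36) ⊂ (1.62) — never conversely.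
[cite: Balaban1985RegularSpaces, Thm 8 p.101 (surviving vs typed); Balaban1989LargeFieldII, Thm 1 + (0.1) pp.355–356 (bookkeeping)] -/
theorem companion_of_isRecordOfRecord₁₂CB10YZWB8subBB12 (h : IsRecordOfRecord₁₂CB10YZWB8subBB12 F N D w) :
    ∃ w' : WorldP, IsRecordOfRecord₁₂CB10YZW F N D w' ∧ w'.C = w.C ∧ w'.γ = w.γ ∧ w'.L = w.L ∧
      (∀ P : B12.RunParams, leavesP w P = { leavesP w' P with b8 := (leavesP w P).b8 }) ∧
      ∀ P : B12.RunParams, (leavesP w' P).b8 → (leavesP w P).b8 := by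
  obtain ⟨θ, hP, lam12, lam, Mstar, ops, ζ, lamW, hθ, hD, hC, hγ, hL, hup⟩ := h
  have hup' : ∀ P, w.up P = (upOfRecord₅C F N (θ.view₁₂B12B8subBB10YZW F N lam12 lam Mstar ops ζ lamW) P).withB8 (leavesP w P).b8 := fun P => by
    show w.up P = (upOfRecord₅C F N _ P).withB8 (w.up P).b8
    rw [hup P]
    rfl
  refine ⟨{ w with up := fun P => upOfRecord₅C F N (θ.view₁₂B12B8subBB10YZW F N lam12 lam Mstar ops ζ lamW) P },
    ⟨(θ.pinB12 F N lam12).pinB8SubB F N lam, (hP.pinB12 lam12).pinB8SubB lam, Mstar, ops, ζ, lamW,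
      (Stage12Params.pinB8SubB_admissible_iff F N _ _).2 ((Stage12Params.pinB12_admissible_iff F N _ _).2 hθ), ?_, hC, hγ, hL, fun P => rfl⟩, rfl, rfl, rfl,
      leavesP_eq_of_up_withB8 hup', fun P h8 => ?_⟩
  · rw [datumOfRecord₁₂_pinB8SubB F N (θ.pinB12 F N lam12) (hP.pinB12 lam12) lam, datumOfRecord₁₂_pinB12 F N θ hP lam12]; exact hD
  · have h8' := (upOfRecord₅C_view₁₂B8subBB10YZW_b8_iff F N (θ.pinB12 F N lam12) lam Mstar ops ζ lamW P).1 h8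
    show (w.up P).b8
    rw [hup P]
    exact (upOfRecord₅CS_view₁₂B12B8subBB10YZW_leaves F N θ lam12 lam Mstar ops ζ lamW P).2.1.2
      (B8LeafKnitRS.b8LeafRS_of_b8LeafR (C136_C162_famB8OfRecordSubB lam.β lam.len) h8')

/-- The `₁₂C` record with the same datum at the companion world (g31's `isRecordOfRecord₁₂C_of_isRecordOfRecord₁₂CB10YZW` after the companion).
[cite: Balaban1989LargeFieldII, Thm 1 + (0.1) pp.355–356 (bookkeeping)] -/
theorem exists_isRecordOfRecord₁₂C_of_isRecordOfRecord₁₂CB10YZWB8subBB12 (h : IsRecordOfRecord₁₂CB10YZWB8subBB12 F N D w) :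
    ∃ w' : WorldP, IsRecordOfRecord₁₂C F N D w' ∧ w'.C = w.C ∧ w'.γ = w.γ ∧ w'.L = w.L ∧
      (∀ P : B12.RunParams, leavesP w P = { leavesP w' P with b8 := (leavesP w P).b8 }) := by
  obtain ⟨w', hw', hC, hγ, hL, hleaves, -⟩ := companion_of_isRecordOfRecord₁₂CB10YZWB8subBB12 h
  exact ⟨w', isRecordOfRecord₁₂C_of_isRecordOfRecord₁₂CB10YZW hw', hC, hγ, hL, hleaves⟩

/-- **THE SIX PINNED LEAVES AT A RECORD OF THIS MODULE, for ONE parameter package**. [cite: Balaban1987RG1, Lemma 4 p.280; Balaban1985RegularSpaces, Lemma 1 – Thm 8 pp.79–101; Balaban1989LargeFieldI, Prop. 1 p.194; Balaban1985BackgroundPropagators, Thm 3.1 p.397; Balaban1985UV3, Thm 1 p.257; Balaban1985Variational, Thm 1 p.279] -/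
theorem leaves_iff_of_isRecordOfRecord₁₂CB10YZWB8subBB12 (h : IsRecordOfRecord₁₂CB10YZWB8subBB12 F N D w) :
    ∃ (θ : Stage12Params F N) (lam12 : ResidB12 F N θ.τ9.M) (lam : ResidB8 θ.toStage3Params) (Mstar : ℕ) (ops : OpsY N θ.toStage3Params Mstar) (ζ : ResidZ F N)
      (lamW : ResidW F N), θ.Admissible F N ∧ w.L = (θ.L : ℝ) ∧ ∀ P : B12.RunParams,
        ((leavesP w P).b12 ↔ B12LeafOfRecord₁₂ F N θ lam12 P) ∧ ((leavesP w P).b8 ↔ B8LeafOfRecordSubB θ.toStage3Params lam) ∧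
        ((leavesP w P).rBasicStep ↔ B15Leaf (WOfRecord₁₂ F N θ lamW P)) ∧ ((leavesP w P).b9 ↔ B9LeafX (Y9OfRecord N θ.toStage3Params Mstar ops)) ∧
        ((leavesP w P).b10 ↔ PrintedUV3V N θ.L) ∧ ((leavesP w P).b11 ↔ B11Leaf (Z11OfRecord F N ζ)) := by
  obtain ⟨θ, -, lam12, lam, Mstar, ops, ζ, lamW, hθ, -, -, -, hL, hup⟩ := h
  refine ⟨θ, lam12, lam, Mstar, ops, ζ, lamW, hθ, hL, fun P => ?_⟩
  have hl := upOfRecord₅CS_view₁₂B12B8subBB10YZW_leaves F N θ lam12 lam Mstar ops ζ lamW P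
  refine ⟨?_, ?_, ?_, ?_, ?_, ?_⟩
  · show (w.up P).b12 ↔ _
    rw [hup P]; exact hl.1
  · show (w.up P).b8 ↔ _
    rw [hup P]; exact hl.2.1
  · show (w.up P).rBasicStep ↔ _
    rw [hup P]; exact hl.2.2.1
  · show (w.up P).b9 ↔ _
    rw [hup P]; exact hl.2.2.2.1
  · show (w.up P).b10 ↔ _
    rw [hup P]; exact hl.2.2.2.2.1
  · show (w.up P).b11 ↔ _
    rw [hup P]; exact hl.2.2.2.2.2

/-- The in-edges `b4 b5 b6 b7` are THEOREMS at a record of this module (via the companion, b8-free). [cite: Balaban1983RegularityDecay, Thm p.573; Balaban1984PropagatorsI, Props. 1.1–1.2 pp.33–36; Balaban1984PropagatorsII, pp.223–250; Balaban1985Averaging, Props. 1–10 pp.26–50 (bookkeeping)] -/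
theorem b4_b5_b6_b7_of_isRecordOfRecord₁₂CB10YZWB8subBB12 (h : IsRecordOfRecord₁₂CB10YZWB8subBB12 F N D w) (P : B12.RunParams) :
    (leavesP w P).b4 ∧ (leavesP w P).b5 ∧ (leavesP w P).b6 ∧ (leavesP w P).b7 := by
  obtain ⟨w', hw', -, -, -, hleaves, -⟩ := companion_of_isRecordOfRecord₁₂CB10YZWB8subBB12 h
  have h' : (leavesP w' P).b4 ∧ (leavesP w' P).b5 ∧ (leavesP w' P).b6 ∧ (leavesP w' P).b7 :=
    atWorld_of_isRecordOfRecord₁₂CB10YZW (X := fun ℓ => ℓ.b4 ∧ ℓ.b5 ∧ ℓ.b6 ∧ ℓ.b7)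
      (fun _ _ h5 P =>
        have h4 := b4_main_of_isRecordOfRecord₅C h5 P
        have hb5 := b5_main_of_isRecordOfRecord₅C h5 P h4
        ⟨h4, hb5, N03_at_record₅C h5 P h4 hb5, b7_main_of_isRecordOfRecord₅C h5 P hb5⟩) hw' P
  rw [hleaves P]
  exact h'

/-- **N05 ∕ N07 ∕ N08 AT A RECORD OF THIS MODULE**: N05 IS «b9 → leaf», N07 IS «leaf → b9 → b11», N08 IS «leaf → b9 → b11 → b10» (the in-edges b4–b7 are theorems).
[cite: Balaban1985RegularSpaces, Thm 2 p.83, Thm 8 p.101; Balaban1985Variational, Thm 1 p.279; Balaban1985UV3, Thm 1 p.257 (bookkeeping)] -/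
theorem b8_b11_b10_main_iff_of_isRecordOfRecord₁₂CB10YZWB8subBB12 (h : IsRecordOfRecord₁₂CB10YZWB8subBB12 F N D w) (P : B12.RunParams) :
    (Dag.B8_main (leavesP w P) ↔ ((leavesP w P).b9 → (leavesP w P).b8)) ∧
    (Dag.B11_main (leavesP w P) ↔ ((leavesP w P).b8 → (leavesP w P).b9 → (leavesP w P).b11)) ∧
    (Dag.B10_main (leavesP w P) ↔ ((leavesP w P).b8 → (leavesP w P).b9 → (leavesP w P).b11 → (leavesP w P).b10)) := by
  obtain ⟨-, h5, h6, h7⟩ := b4_b5_b6_b7_of_isRecordOfRecord₁₂CB10YZWB8subBB12 h P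
  exact ⟨⟨fun hN h9 => hN h5 h6 h7 h9, fun hN _ _ _ => hN⟩, ⟨fun hN h8 h9 => hN h5 h6 h7 h8 h9, fun hN _ _ _ => hN⟩,
    ⟨fun hN h8 h9 h11 => hN h5 h6 h7 h8 h9 h11, fun hN _ _ _ => hN⟩⟩

/-- **N05 ∕ N07 ∕ N08 AT THE BUNDLES OF RECORD, for ONE parameter package** (the port form, `B8LeafOfRecordSubB` DISPLAYED).
[cite: Balaban1985RegularSpaces, Thm 2 p.83, Thm 8 p.101; Balaban1985Variational, Thm 1 p.279; Balaban1985UV3, Thm 1 p.257 + Thm 2 p.272 (the nodes at the objects of record)] -/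
theorem nodes_iff_bundles_of_isRecordOfRecord₁₂CB10YZWB8subBB12 (h : IsRecordOfRecord₁₂CB10YZWB8subBB12 F N D w) :
    ∃ (θ : Stage12Params F N) (lam : ResidB8 θ.toStage3Params) (Mstar : ℕ) (ops : OpsY N θ.toStage3Params Mstar) (ζ : ResidZ F N), θ.Admissible F N ∧ w.L = (θ.L : ℝ) ∧
      ∀ P : B12.RunParams,
        (Dag.B8_main (leavesP w P) ↔ (B9LeafX (Y9OfRecord N θ.toStage3Params Mstar ops) → B8LeafOfRecordSubB θ.toStage3Params lam)) ∧
        (Dag.B11_main (leavesP w P) ↔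
          (B8LeafOfRecordSubB θ.toStage3Params lam → B9LeafX (Y9OfRecord N θ.toStage3Params Mstar ops) → B11Leaf (Z11OfRecord F N ζ))) ∧
        (Dag.B10_main (leavesP w P) ↔
          (B8LeafOfRecordSubB θ.toStage3Params lam → B9LeafX (Y9OfRecord N θ.toStage3Params Mstar ops) → B11Leaf (Z11OfRecord F N ζ) → PrintedUV3V N θ.L)) := by
  obtain ⟨θ, lam12, lam, Mstar, ops, ζ, lamW, hθ, hL, hl⟩ := leaves_iff_of_isRecordOfRecord₁₂CB10YZWB8subBB12 h
  refine ⟨θ, lam, Mstar, ops, ζ, hθ, hL, fun P => ?_⟩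
  obtain ⟨h8, h11, h10⟩ := b8_b11_b10_main_iff_of_isRecordOfRecord₁₂CB10YZWB8subBB12 h P
  rw [h8, h11, h10, (hl P).2.1, (hl P).2.2.2.1, (hl P).2.2.2.2.1, (hl P).2.2.2.2.2]
  exact ⟨Iff.rfl, Iff.rfl, Iff.rfl⟩

/-- **N05 «SLOTS» FORM at a record of this module** — the closer proves the FOUR-LAW SUB-FAMILY leaf at every presenting package (through `b8LeafOfRecordSubB_of_b8LeafOfRecord` ∕
`…_of_b8LeafOfRecordSub` from a larger-family closer, or directly on the four-law sub-family where the index laws №7∕№8∕№11∕№12 are available as hypotheses `i.2` — the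
knits of record `BalabanUVNodesN05SubBKnit(ZdLan)`). [cite: Balaban1985RegularSpaces, Lemma 1 – Thm 8 pp.79–101 (the node's shape, bookkeeping)] -/
theorem b8_main_of_isRecordOfRecord₁₂CB10YZWB8subBB12_of_slots (h : IsRecordOfRecord₁₂CB10YZWB8subBB12 F N D w)
    (hB : ∀ (θ : Stage12Params F N) (hP : θ.Provisos₁₂ F N) (lam12 : ResidB12 F N θ.τ9.M) (lam : ResidB8 θ.toStage3Params) (Mstar : ℕ) (ops : OpsY N θ.toStage3Params Mstar)
      (ζ : ResidZ F N) (lamW : ResidW F N), θ.Admissible F N → D = datumOfRecord₁₂ F N θ hP →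
        (∀ P, w.up P = upOfRecord₅CS F N (θ.view₁₂B12B8subBB10YZW F N lam12 lam Mstar ops ζ lamW) P) → B8LeafOfRecordSubB θ.toStage3Params lam)
    (P : B12.RunParams) : Dag.B8_main (leavesP w P) := by
  obtain ⟨θ, hP, lam12, lam, Mstar, ops, ζ, lamW, hθ, hD, -, -, -, hup⟩ := h
  intro _ _ _ _
  show (w.up P).b8
  rw [hup P]
  exact (upOfRecord₅CS_view₁₂B12B8subBB10YZW_leaves F N θ lam12 lam Mstar ops ζ lamW P).2.1.2 (hB θ hP lam12 lam Mstar ops ζ lamW hθ hD hup)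

/-- **N09's CONJUNCT 1 «SLOTS» FORM at a record of this module** (a closer supplies the companion face «displayed by-reference package ⇒ `B12LeafOfRecord₁₂`» of seat
node00-def-B12). [cite: Balaban1987RG1, Lemma 4 (3.53) p.280 (the node's conjunct 1, bookkeeping)] -/
theorem b12_leaf_of_isRecordOfRecord₁₂CB10YZWB8subBB12_of_slots (h : IsRecordOfRecord₁₂CB10YZWB8subBB12 F N D w)
    (hB : ∀ (θ : Stage12Params F N) (hP : θ.Provisos₁₂ F N) (lam12 : ResidB12 F N θ.τ9.M) (lam : ResidB8 θ.toStage3Params) (Mstar : ℕ) (ops : OpsY N θ.toStage3Params Mstar)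
      (ζ : ResidZ F N) (lamW : ResidW F N), θ.Admissible F N → D = datumOfRecord₁₂ F N θ hP →
        (∀ P, w.up P = upOfRecord₅CS F N (θ.view₁₂B12B8subBB10YZW F N lam12 lam Mstar ops ζ lamW) P) → ∀ P, B12LeafOfRecord₁₂ F N θ lam12 P)
    (P : B12.RunParams) : (leavesP w P).b12 := by
  obtain ⟨θ, hP, lam12, lam, Mstar, ops, ζ, lamW, hθ, hD, -, -, -, hup⟩ := h
  show (w.up P).b12
  rw [hup P]
  exact (upOfRecord₅CS_view₁₂B12B8subBB10YZW_leaves F N θ lam12 lam Mstar ops ζ lamW P).1.2 (hB θ hP lam12 lam Mstar ops ζ lamW hθ hD hup P)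

/-- RE-BINDING a `₁₂C` record's world by the S-binding at the six-pin view with [B8″] gives a record of this module with the SAME datum — the ∃-currency entry point: the
six residual layers (in particular the [B8] layer `lam`, e.g. the cut layer `λ.cutSubB J lan c₁` of `Node00/CarriersB8SubB` at which the knits of record conclude) are CHOSEN here.
[cite: Balaban1989LargeFieldII, Thm 1 p.355 (bookkeeping)] -/
theorem isRecordOfRecord₁₂CB10YZWB8subBB12_rebind_of_isRecordOfRecord₁₂C (h : IsRecordOfRecord₁₂C F N D w) :
    ∃ (θ : Stage12Params F N) (_ : θ.Provisos₁₂ F N), θ.Admissible F N ∧ (∀ P, w.up P = upOfRecord₅C F N (θ.toStage5₁₂ F N) P) ∧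
      ∀ (lam12 : ResidB12 F N θ.τ9.M) (lam : ResidB8 θ.toStage3Params) (Mstar : ℕ) (ops : OpsY N θ.toStage3Params Mstar) (ζ : ResidZ F N) (lamW : ResidW F N),
        IsRecordOfRecord₁₂CB10YZWB8subBB12 F N D { w with up := fun P => upOfRecord₅CS F N (θ.view₁₂B12B8subBB10YZW F N lam12 lam Mstar ops ζ lamW) P } := by
  obtain ⟨θ, hP, hθ, hD, hC, hγ, hL, hup⟩ := h
  exact ⟨θ, hP, hθ, hup, fun lam12 lam Mstar ops ζ lamW => ⟨θ, hP, lam12, lam, Mstar, ops, ζ, lamW, hθ, hD, hC, hγ, hL, fun _ => rfl⟩⟩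

/-- **OLD ⇒ NEW AT THE RECORD LEVEL**: a three-law record (`IsRecordOfRecord₁₂CB10YZWB8subB12`, g32) gives the four-law record WITH THE SAME DATUM at the re-keyed world — same
`C`, window, `L`; the leaves `b12`, `rBasicStep`, `b9`, `b10`, `b11`, `b4`–`b7`, `b13`, `rOperation` are EQUAL and the new `b8` is IMPLIED by the old one
(`b8LeafOfRecordSubB_of_b8LeafOfRecordSub`). [cite: Balaban1985RegularSpaces, Lemma 1 – Thm 8 pp.79–101 (restriction of the family index); Balaban1989LargeFieldII, Thm 1 p.355 (bookkeeping)] -/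
theorem exists_isRecordOfRecord₁₂CB10YZWB8subBB12_of_isRecordOfRecord₁₂CB10YZWB8subB12 (h : IsRecordOfRecord₁₂CB10YZWB8subB12 F N D w) :
    ∃ w' : WorldP, IsRecordOfRecord₁₂CB10YZWB8subBB12 F N D w' ∧ w'.C = w.C ∧ w'.γ = w.γ ∧ w'.L = w.L ∧
      (∀ P : B12.RunParams, leavesP w' P = { leavesP w P with b8 := (leavesP w' P).b8 }) ∧
      ∀ P : B12.RunParams, (leavesP w P).b8 → (leavesP w' P).b8 := by
  obtain ⟨θ, hP, lam12, lam, Mstar, ops, ζ, lamW, hθ, hD, hC, hγ, hL, hup⟩ := h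
  refine ⟨{ w with up := fun P => upOfRecord₅CS F N (θ.view₁₂B12B8subBB10YZW F N lam12 lam Mstar ops ζ lamW) P },
    ⟨θ, hP, lam12, lam, Mstar, ops, ζ, lamW, hθ, hD, hC, hγ, hL, fun _ => rfl⟩, rfl, rfl, rfl, fun P => ?_, fun P h8 => ?_⟩
  · have hup' : ∀ P, upOfRecord₅CS F N (θ.view₁₂B12B8subBB10YZW F N lam12 lam Mstar ops ζ lamW) P =
        (w.up P).withB8 (upOfRecord₅CS F N (θ.view₁₂B12B8subBB10YZW F N lam12 lam Mstar ops ζ lamW) P).b8 := fun P => by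
      rw [hup P]; rfl
    exact leavesP_eq_of_up_withB8 (w := { w with up := fun P => upOfRecord₅CS F N (θ.view₁₂B12B8subBB10YZW F N lam12 lam Mstar ops ζ lamW) P })
      (u := w.up) hup' P
  · have h8' : B8LeafOfRecordSub θ.toStage3Params lam := by
      have h8w : (w.up P).b8 := h8
      rw [hup P] at h8w
      exact (upOfRecord₅CS_view₁₂B12B8subB10YZW_leaves F N θ lam12 lam Mstar ops ζ lamW P).2.1.1 h8w
    show (upOfRecord₅CS F N (θ.view₁₂B12B8subBB10YZW F N lam12 lam Mstar ops ζ lamW) P).b8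
    exact (upOfRecord₅CS_view₁₂B12B8subBB10YZW_leaves F N θ lam12 lam Mstar ops ζ lamW P).2.1.2 (b8LeafOfRecordSubB_of_b8LeafOfRecordSub lam h8')

end Record12B8subB

end Literature.MathematicalPhysics.QuantumFieldTheory.Balaban1983to89.Node00

end
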